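import Summits.NavierStokesRegularity.NavierStokesRegularity.Theses.AdaptedFrequency
import Literature.Analysis.FluidPDE.AdaptedBackwardKernel
import Literature.Analysis.FluidPDE.ClassicalSolution
import Literature.Analysis.FluidPDE.IsometryInvariance
import Literature.Analysis.FluidPDE.VectorCalculusProofs
import Literature.Analysis.FluidPDE.TaoEnstrophyLocalisation

/-!
# Stub `stub_corotationNeutral` of line `cloud-frame-effective-tsai`
# (crux `AdaptedFrequencyConverges`, stmt-NavierStokesRegularity-10493)

**Co-rotation neutrality.** For a pair `(v, K)` that is rotated self-similar modulo a wobble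
with co-moving kernel,
`v(t, x) = (−t)^{-1/2} R_t V((−t)^{-1/2} R_t⁻¹ (x − m_t)) + w_t`,
`K(t, x) = (−t)^{-3/2} 𝒦((−t)^{-1/2} R_t⁻¹ (x − m_t))` for `t < 0` (`R_t` a linear isometry of
`ℝ³`, `m_t` a translation, `w_t` a spatially constant boost), the rescaled adapted enstrophy
`h̄(t) = (−t)² ∫ ‖curl v(t, x)‖² K(t, x) dx` does not depend on `t`: it equals
`∫ ‖curl V(y)‖² 𝒦(y) dy` for every `t < 0` (`rescaledAdaptedEnstrophy_eq`). Pure change of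
variables, no PDE and no integrability or differentiability hypothesis (Mathlib's `fderiv`,
Bochner integral and change-of-variables formulas are unconditional):

* `‖curl (R ∘ V ∘ R⁻¹)(x)‖ = ‖curl V (R⁻¹ x)‖` for a linear isometry `R` (`norm_curl_conj_sq`):
  `D(R V R⁻¹)(x) = R DV(R⁻¹x) R⁻¹` (`fderiv_conj_linearIsometryEquiv`),
  `‖curl f x‖² = ½|Df − Dfᵀ|²` (the tree's `norm_curl_sq_eq_frobeniusNormSq_spin_holds`),
  `(R M R⁻¹)ᵀ = R Mᵀ R⁻¹` and the Frobenius norm is invariant under conjugation by `R`;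
* `curl (c • W(c ·))(z) = c² (curl W)(c z)` and `curl (G(· − a) + w) (x) = curl G (x − a)`;
* Lebesgue measure on `ℝ³` is invariant under translations and linear isometries and
  `∫ F(c y) dy = c⁻³ ∫ F`; finally `(−t)² · c⁴ · (−t)^{-3/2} · c⁻³ = 1` for `c = (−t)^{-1/2}`.
-/

noncomputable section

namespace Summit.NavierStokesRegularity.NavierStokesRegularity.Theorems.AdaptedFrequencyConverges.CloudFrameEffectiveTsai

open scoped Topology
open Literature.Analysis.FluidPDE Set Filter MeasureTheory Function

/-! ### Curl algebra: rotations, dilations, translations -/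

/-- `‖curl f (x)‖² = ½ |Df(x) − Df(x)ᵀ|²` (Frobenius norm), with no differentiability hypothesis:
the tree's `norm_curl_sq_eq_frobeniusNormSq_spin_holds` applied to the linear map `Df(x)` at `0`
(both sides only depend on the Jacobian). -/
theorem norm_curl_sq_eq_half_frobeniusNormSq
    (f : EuclideanSpace ℝ (Fin 3) → EuclideanSpace ℝ (Fin 3)) (x : EuclideanSpace ℝ (Fin 3)) :
    ‖curl f x‖ ^ 2 =
      2⁻¹ * frobeniusNormSq (fderiv ℝ f x - ContinuousLinearMap.adjoint (fderiv ℝ f x)) := by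
  have h := norm_curl_sq_eq_frobeniusNormSq_spin_holds (⇑(fderiv ℝ f x)) 0
    (fderiv ℝ f x).differentiableAt
  have hc : curl (⇑(fderiv ℝ f x)) 0 = curl f x := by
    simp only [curl, ContinuousLinearMap.fderiv]
  simp only [spin, ContinuousLinearMap.fderiv] at h
  rw [hc] at h
  exact h

section Conj

variable (R : EuclideanSpace ℝ (Fin 3) ≃ₗᵢ[ℝ] EuclideanSpace ℝ (Fin 3))

/-- The Frobenius norm is invariant under conjugation by a linear isometry:
`|R ∘ A ∘ R⁻¹|² = |A|²` (sum over the orthonormal basis `R b`). -/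
theorem frobeniusNormSq_conj (A : EuclideanSpace ℝ (Fin 3) →L[ℝ] EuclideanSpace ℝ (Fin 3)) :
    frobeniusNormSq ((R : EuclideanSpace ℝ (Fin 3) →L[ℝ] EuclideanSpace ℝ (Fin 3)).comp
      (A.comp (R.symm : EuclideanSpace ℝ (Fin 3) →L[ℝ] EuclideanSpace ℝ (Fin 3)))) =
      frobeniusNormSq A := by
  -- adapted from `frobeniusNormSq_conj_linearIsometryEquiv`
  -- (Literature/Analysis/FluidPDE/AxisymmetricTypeIOffAxis.lean)
  rw [frobeniusNormSq_eq_sum ((stdOrthonormalBasis ℝ (EuclideanSpace ℝ (Fin 3))).map R),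
    frobeniusNormSq_eq_sum (stdOrthonormalBasis ℝ (EuclideanSpace ℝ (Fin 3)))]
  refine Finset.sum_congr rfl fun i _ => ?_
  simp [OrthonormalBasis.map_apply]

/-- The adjoint of a conjugate by a linear isometry: `(R A R⁻¹)ᵀ = R Aᵀ R⁻¹` (`Rᵀ = R⁻¹`). -/
theorem adjoint_conj (A : EuclideanSpace ℝ (Fin 3) →L[ℝ] EuclideanSpace ℝ (Fin 3)) :
    ContinuousLinearMap.adjoint ((R : EuclideanSpace ℝ (Fin 3) →L[ℝ] EuclideanSpace ℝ (Fin 3)).comp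
      (A.comp (R.symm : EuclideanSpace ℝ (Fin 3) →L[ℝ] EuclideanSpace ℝ (Fin 3)))) =
      (R : EuclideanSpace ℝ (Fin 3) →L[ℝ] EuclideanSpace ℝ (Fin 3)).comp
        ((ContinuousLinearMap.adjoint A).comp
          (R.symm : EuclideanSpace ℝ (Fin 3) →L[ℝ] EuclideanSpace ℝ (Fin 3))) := by
  rw [ContinuousLinearMap.adjoint_comp, ContinuousLinearMap.adjoint_comp,
    LinearIsometryEquiv.adjoint_eq_symm, LinearIsometryEquiv.adjoint_eq_symm,
    LinearIsometryEquiv.symm_symm, ContinuousLinearMap.comp_assoc]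

/-- **The curl is `O(3)`-equivariant up to sign**, norm form: for a linear isometry `R` of `ℝ³`
and any field `V`, `‖curl (R ∘ V ∘ R⁻¹) (x)‖² = ‖(curl V)(R⁻¹ x)‖²` (no differentiability
hypothesis: both sides are junk together). -/
theorem norm_curl_conj_sq (V : EuclideanSpace ℝ (Fin 3) → EuclideanSpace ℝ (Fin 3))
    (x : EuclideanSpace ℝ (Fin 3)) :
    ‖curl (fun y => R (V (R.symm y))) x‖ ^ 2 = ‖curl V (R.symm x)‖ ^ 2 := by
  rw [norm_curl_sq_eq_half_frobeniusNormSq, norm_curl_sq_eq_half_frobeniusNormSq,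
    fderiv_conj_linearIsometryEquiv, adjoint_conj, ← ContinuousLinearMap.comp_sub,
    ← ContinuousLinearMap.sub_comp, frobeniusNormSq_conj]

end Conj

/-- **Curl of a dilation**: `curl (k • f(c ·))(x) = (k c) • (curl f)(c x)` for all `k c : ℝ`, no
differentiability hypothesis. -/
theorem curl_smul_comp_smul_apply (f : EuclideanSpace ℝ (Fin 3) → EuclideanSpace ℝ (Fin 3))
    (k c : ℝ) (x : EuclideanSpace ℝ (Fin 3)) :
    curl (fun y => k • f (c • y)) x = (k * c) • curl f (c • x) := by
  -- adapted from `curl_smul_comp_smul` (Literature/Analysis/FluidPDE/FlatSwirlGauge.lean)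
  have hD : fderiv ℝ (fun y => k • f (c • y)) x = (k * c) • fderiv ℝ f (c • x) := by
    have h : (fun y => k • f (c • y)) = k • fun y => f (c • y) := rfl
    rw [h, fderiv_const_smul_field, Pi.smul_apply, _root_.fderiv_comp_smul, smul_smul]
  rw [curl_eq_curlCLM, curl_eq_curlCLM, hD, map_smul]

/-- **Curl of a translate plus a constant boost**: `curl (g(· − a) + w)(x) = (curl g)(x − a)`,
no differentiability hypothesis. -/
theorem curl_comp_sub_add_const (g : EuclideanSpace ℝ (Fin 3) → EuclideanSpace ℝ (Fin 3))
    (a w x : EuclideanSpace ℝ (Fin 3)) :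
    curl (fun y => g (y - a) + w) x = curl g (x - a) := by
  rw [curl_eq_curlCLM, curl_eq_curlCLM, fderiv_add_const, fderiv_comp_sub]

/-! ### Bookkeeping of the powers of `−t` -/

/-- `s² · c⁴ · s^{-3/2} · (c³)⁻¹ = 1` for `c = (√s)⁻¹`, `s > 0`. -/
theorem scale_bookkeeping {s : ℝ} (hs : 0 < s) :
    s ^ 2 * (((Real.sqrt s)⁻¹ * (Real.sqrt s)⁻¹) ^ 2 * s ^ (-(3:ℝ) / 2)) *
      ((Real.sqrt s)⁻¹ ^ 3)⁻¹ = 1 := by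
  have hr : 0 < Real.sqrt s := Real.sqrt_pos.2 hs
  have h32 : s ^ (-(3:ℝ) / 2) = (Real.sqrt s ^ 3)⁻¹ := by
    rw [neg_div, Real.rpow_neg hs.le, show (3:ℝ) / 2 = (1 / 2) * 3 by norm_num,
      Real.rpow_mul hs.le, ← Real.sqrt_eq_rpow, show (3:ℝ) = ((3:ℕ):ℝ) by norm_num,
      Real.rpow_natCast]
  have hs2 : s ^ 2 = Real.sqrt s ^ 4 := by
    calc s ^ 2 = (Real.sqrt s ^ 2) ^ 2 := by rw [Real.sq_sqrt hs.le]
      _ = Real.sqrt s ^ 4 := by ring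
  rw [h32, hs2]
  field_simp

/-! ### The change of variables -/

/-- **The rescaled adapted enstrophy of a rotated self-similar pair modulo wobble is explicit**:
for `t < 0`, `(−t)² ∫ ‖curl v(t, x)‖² K(t, x) dx = ∫ ‖curl V(y)‖² 𝒦(y) dy`
(substitute `y = (−t)^{-1/2} R_t⁻¹ (x − m_t)`: translation invariance, isometry invariance and
the scaling `∫ F(c y) dy = c⁻³ ∫ F` of Lebesgue measure, and `scale_bookkeeping`). -/
theorem rescaledAdaptedEnstrophy_eq
    (v : ℝ → EuclideanSpace ℝ (Fin 3) → EuclideanSpace ℝ (Fin 3))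
    (K : ℝ → EuclideanSpace ℝ (Fin 3) → ℝ)
    (V : EuclideanSpace ℝ (Fin 3) → EuclideanSpace ℝ (Fin 3)) (𝒦 : EuclideanSpace ℝ (Fin 3) → ℝ)
    (R : ℝ → (EuclideanSpace ℝ (Fin 3) ≃ₗᵢ[ℝ] EuclideanSpace ℝ (Fin 3)))
    (m w : ℝ → EuclideanSpace ℝ (Fin 3))
    (hv : ∀ t ∈ Iio (0:ℝ), ∀ x, v t x =
      (Real.sqrt (-t))⁻¹ • (R t) (V ((Real.sqrt (-t))⁻¹ • (R t).symm (x - m t))) + w t)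
    (hK : ∀ t ∈ Iio (0:ℝ), ∀ x,
      K t x = (-t) ^ (-(3:ℝ) / 2) * 𝒦 ((Real.sqrt (-t))⁻¹ • (R t).symm (x - m t)))
    {t : ℝ} (ht : t < 0) :
    (-t) ^ 2 * adaptedEnstrophy v K t = ∫ y, ‖curl V y‖ ^ 2 * 𝒦 y := by
  have hs : 0 < -t := neg_pos.2 ht
  have hvt := hv t ht
  have hKt := hK t ht
  have hbook := scale_bookkeeping hs
  obtain ⟨c, hc⟩ : ∃ c : ℝ, (Real.sqrt (-t))⁻¹ = c := ⟨_, rfl⟩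
  have hc0 : 0 < c := hc ▸ inv_pos.2 (Real.sqrt_pos.2 hs)
  rw [hc] at hvt hKt hbook
  -- the integrand after the change of variables
  obtain ⟨F, hF⟩ : ∃ F : EuclideanSpace ℝ (Fin 3) → ℝ, F = fun y => ‖curl V y‖ ^ 2 * 𝒦 y :=
    ⟨_, rfl⟩
  -- the conjugated profile and its dilation
  obtain ⟨W, hW⟩ : ∃ W : EuclideanSpace ℝ (Fin 3) → EuclideanSpace ℝ (Fin 3),
    W = fun y => R t (V ((R t).symm y)) := ⟨_, rfl⟩
  obtain ⟨G, hG⟩ : ∃ G : EuclideanSpace ℝ (Fin 3) → EuclideanSpace ℝ (Fin 3),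
    G = fun z => c • W (c • z) := ⟨_, rfl⟩
  have hvt' : v t = fun x => G (x - m t) + w t := by
    funext x
    rw [hvt x, hG, hW]
    simp only [map_smul]
  -- pointwise: `‖curl v(t, x)‖² = c⁴ ‖curl V (c R_t⁻¹ (x − m_t))‖²`
  have hcurl : ∀ x,
      ‖curl (v t) x‖ ^ 2 = (c * c) ^ 2 * ‖curl V (c • (R t).symm (x - m t))‖ ^ 2 := by
    intro x
    rw [hvt', curl_comp_sub_add_const, hG, curl_smul_comp_smul_apply, norm_smul, mul_pow,
      Real.norm_eq_abs, sq_abs, hW, norm_curl_conj_sq, map_smul]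
  have hpt : ∀ x, ‖curl (v t) x‖ ^ 2 * K t x =
      ((c * c) ^ 2 * (-t) ^ (-(3:ℝ) / 2)) * F (c • (R t).symm (x - m t)) := by
    intro x
    rw [hcurl x, hKt x, hF]
    ring
  -- the three changes of variables
  have h1 : ∫ x, F (c • (R t).symm (x - m t)) = ∫ x, F (c • (R t).symm x) :=
    integral_sub_right_eq_self (fun x => F (c • (R t).symm x)) (m t)
  have h2 : ∫ x, F (c • (R t).symm x) = ∫ y, F (c • y) :=
    (R t).symm.measurePreserving.integral_comp (R t).symm.toHomeomorph.measurableEmbedding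
      (fun y => F (c • y))
  have h3 : ∫ y, F (c • y) = (c ^ 3)⁻¹ * ∫ y, F y := by
    have h := Measure.integral_comp_smul_of_nonneg (volume : Measure (EuclideanSpace ℝ (Fin 3)))
      F c (hR := hc0.le)
    rw [finrank_euclideanSpace_fin, smul_eq_mul] at h
    exact h
  rw [adaptedEnstrophy_apply]
  simp_rw [hpt]
  rw [integral_const_mul, h1, h2, h3, hF]
  calc (-t) ^ 2 * ((c * c) ^ 2 * (-t) ^ (-(3:ℝ) / 2) * ((c ^ 3)⁻¹ * ∫ y, ‖curl V y‖ ^ 2 * 𝒦 y))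
      = ((-t) ^ 2 * ((c * c) ^ 2 * (-t) ^ (-(3:ℝ) / 2)) * (c ^ 3)⁻¹) *
          ∫ y, ‖curl V y‖ ^ 2 * 𝒦 y := by ring
    _ = ∫ y, ‖curl V y‖ ^ 2 * 𝒦 y := by rw [hbook, one_mul]

/-! ### The stub -/

/-- **Co-rotation neutrality** (stub `stub_corotationNeutral` of line `cloud-frame-effective-tsai`):
for a pair `(v, K)` that is rotated self-similar modulo a wobble with co-moving kernel (the
representation produced by `stub_rotatedHull`, with differentiable profile), the rescaled adapted
enstrophy `(−τ)² ∫ ‖curl v(τ)‖² K(τ)` is the same at any two negative times: by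
`rescaledAdaptedEnstrophy_eq` both equal `∫ ‖curl V‖² 𝒦`. (The differentiability of the profile
is not needed.) -/
theorem stub_corotationNeutral :
    ∀ (v : ℝ → (EuclideanSpace ℝ (Fin 3)) → (EuclideanSpace ℝ (Fin 3))) (K : ℝ → (EuclideanSpace ℝ (Fin 3)) → ℝ) (V : (EuclideanSpace ℝ (Fin 3)) → (EuclideanSpace ℝ (Fin 3))) (𝒦 : (EuclideanSpace ℝ (Fin 3)) → ℝ) (R : ℝ → ((EuclideanSpace ℝ (Fin 3)) ≃ₗᵢ[ℝ] (EuclideanSpace ℝ (Fin 3)))) (m w : ℝ → (EuclideanSpace ℝ (Fin 3))), Differentiable ℝ V → (∀ t ∈ Iio (0:ℝ), ∀ x, v t x = (Real.sqrt (-t))⁻¹ • (R t) (V ((Real.sqrt (-t))⁻¹ • (R t).symm (x - m t))) + w t) → (∀ t ∈ Iio (0:ℝ), ∀ x, K t x = (-t) ^ (-(3:ℝ) / 2) * 𝒦 ((Real.sqrt (-t))⁻¹ • (R t).symm (x - m t))) → ∀ τ₁ τ₂ : ℝ, τ₁ < 0 → τ₂ < 0 → (-τ₁) ^ 2 * adaptedEnstrophy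 v K τ₁ = (-τ₂) ^ 2 * adaptedEnstrophy v K τ₂ := by
  intro v K V 𝒦 R m w _hV hv hK τ₁ τ₂ hτ₁ hτ₂
  rw [rescaledAdaptedEnstrophy_eq v K V 𝒦 R m w hv hK hτ₁,
    rescaledAdaptedEnstrophy_eq v K V 𝒦 R m w hv hK hτ₂]

end Summit.NavierStokesRegularity.NavierStokesRegularity.Theorems.AdaptedFrequencyConverges.CloudFrameEffectiveTsai

end
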